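import Literature.NumberTheory.GelbartRogawski1991.LocalSplittingL2Metaplectic
import Literature.NumberTheory.GelbartRogawski1991.Prop311AsPrinted
import HarnessLib

/-!
# The local metaplectic group of BOUNDED pairs over `L²(F_vᴺ)` is a central extension `1 → ℂˣ → Mp_v(W) → Sp(𝕎_v) → 1`

Topic `NumberTheory/GelbartRogawski1991`; namespace `Literature.NumberTheory.GelbartRogawski1991.UnitaryDualPair.LocalSplitting`
(+ §1 in `Literature.NumberTheory.Automorphic.SchwartzBruhat`, §2 in `Literature.RepresentationTheory.HeisenbergGroup`).  KERNEL
ONLY: definitions with bodies (`SchwartzBruhat.unitaryExtend`, `localMpL2Bdd`, `.proj`, `.ofScalar`,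
`LocalSplittingDatum.localSplittingL2Bdd`) and proved theorems; no named fact, no record, no `sorry`.

[GelbartRogawski1991, §3.1 p. 454 L21–29]: "`Mp_𝐀(W)` [is] the group of pairs `(g, M_g)` where `g ∈ Sp_𝐀(W)` and `M_g` is an
operator on the space of `ρ_ψ` such that `M_g ρ_ψ(h) M_g⁻¹ = ρ_ψ(g(h))` … The projection `π((g, M_g)) = g` yields an exact
sequence `0 ⟶ ℂ* ⟶ Mp_𝐀(W) ⟶ Sp_𝐀(W) ⟶ 0`.  For each finite place `v` of `F`, the local metaplectic covering
`π_v : Mp_v(W) → Sp_v(W)` is defined similarly."  The tree's `Prop311AsPrinted` (rendering R4) reads "operator" as a BOUNDED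
operator with bounded inverse (`Prop311.boundedUnits`) and flags the exactness as "a printed CLAIM about the objects …
consumers needing it must prove it for their `ρ_ψ`".  This file PROVES it at a finite place for the tree's unitary model
`ρ_{ψ_v}` on `L²(F_vᴺ)` (`localSchrodingerL2`, irreducible by `LocalSplittingL2Metaplectic.localSchrodingerL2_irreducible`):

* §1 (generic) `SchwartzBruhat.unitaryExtend` — the unitary extension to `L²(X, ν)` of ONE `L²`-isometric linear automorphism
  of `𝒮(X)` (Mathlib's `LinearEquiv.extendOfIsometry`), `unitaryExtend_toLp`;
* §2 (generic) `mem_MpPsi_schrodingerL2_unitaryExtend` — a smooth pair `(g, M) ∈ S̃p_ψ(W)` with `M` `L²`-isometric gives the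
  unitary pair `(g, Û) ∈ MpPsi (schrodingerL2 …)`;
* §3 **`localMpL2Bdd F N T v μ'`** `:= MpPsi (localSchrodingerL2 …) ⊓ (bounded, boundedly invertible)` — the printed
  `Mp_v(W)`; `proj` (`π_v`), `ofScalar` (`i : ℂˣ → Mp_v(W)`, `c ↦ (1, c · id)`); **`proj_surjective`** (every
  `g ∈ Sp(𝕎_v)` has a UNITARY implementer: the tree's `exists_isometric_implementer_localSchrodinger` + §1–§2);
  **`mem_range_ofScalar_of_proj_eq_one`** (`ker π_v = i(ℂˣ)`: a bounded operator commuting with the irreducible `ρ_{ψ_v}`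
  is a scalar — `hasScalarCommutant_localSchrodingerL2`); `ofScalar_mem_center`; assembled as
  **`isCentralExt_localMpL2Bdd : IsCentralExt ofScalar proj`** (the tree's predicate of [MoeglinVignerasWaldspurger1987,
  Chap. 2 II.1 (B)]); consequently two homomorphisms into `Mp_v(W)` over the same map to `Sp(𝕎_v)` differ by a character
  `η : G →* ℂˣ` (`exists_character_of_proj_eq`), unitary if both act by isometries (`norm_character_eq_one_of_proj_eq`) —
  the local form of [GelbartRogawski1991, §3.1 Remark p. 457];
* §4 **`LocalSplittingDatum.localSplittingL2Bdd`** — the tree's local splitting `s_v` (`localSplittingL2`) lands in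
  `Mp_v(W)` = `localMpL2Bdd` (its operators are unitary), over `ι_v` (`proj_localSplittingL2Bdd`).

So, at a finite place and for the tree's model of `ρ_{ψ_v}`, all the printed local objects of [GelbartRogawski1991, §3.1]
exist in the kernel with the printed properties, and `π_v` splits over `U(J)(F_v)`.  Not addressed: uniqueness of `ρ_ψ`
(Stone–von Neumann), the restricted product `∏′ Mp_v(W) → Mp_𝐀(W)` and the global statement; `Prop311AsPrinted` is untouched;
HC_CM is not touched.

## References
* [GelbartRogawski1991] S. Gelbart, J. Rogawski, Invent. Math. 105 (1991) 445–472, §3.1 p. 454 L21–29, Prop. 3.1.1 p. 455 L1–3.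
* [MoeglinVignerasWaldspurger1987] C. Mœglin, M.-F. Vignéras, J.-L. Waldspurger, LNM 1291 (1987), Chap. 2 II.1 (A), (B).
* [Weil1964] A. Weil, Acta Math. 111 (1964) 143–211, Chap. I n° 11–13, Chap. III n° 34.
-/

set_option autoImplicit false

noncomputable section

open _root_.MeasureTheory Set _root_.Filter
open scoped ENNReal NNReal Topology

/-! ## §1 The unitary extension of one `L²`-isometric automorphism of `𝒮(X)` -/

namespace Literature.NumberTheory.Automorphic.SchwartzBruhat

variable {X : Type*} [TopologicalSpace X] [MeasurableSpace X] [OpensMeasurableSpace X] (ν : Measure X)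
  [IsFiniteMeasureOnCompacts ν]

/-- **the unitary operator of `L²(X, ν)` extending an `L²`-isometric linear automorphism `M` of `𝒮(X)`** (dense range of
`toLp` assumed). [cite: Weil1964, Chap. I n° 13] -/
def unitaryExtend (M : SchwartzBruhat X ≃ₗ[ℂ] SchwartzBruhat X) (hM : ∀ Φ, l2NormSq ν (M Φ) = l2NormSq ν Φ)
    (hd : DenseRange (toLp ν : SchwartzBruhat X → Lp ℂ 2 ν)) : Lp ℂ 2 ν ≃ₗᵢ[ℂ] Lp ℂ 2 ν :=
  M.extendOfIsometry (toLp ν) (toLp ν) hd hd fun Φ => norm_toLp_eq_of_l2NormSq_eq ν (hM Φ)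

/-- `Û [Φ] = [M Φ]`. [cite: Weil1964, Chap. I n° 13] -/
@[simp] theorem unitaryExtend_toLp (M : SchwartzBruhat X ≃ₗ[ℂ] SchwartzBruhat X)
    (hM : ∀ Φ, l2NormSq ν (M Φ) = l2NormSq ν Φ) (hd : DenseRange (toLp ν : SchwartzBruhat X → Lp ℂ 2 ν))
    (Φ : SchwartzBruhat X) : unitaryExtend ν M hM hd (toLp ν Φ) = toLp ν (M Φ) :=
  LinearEquiv.extendOfIsometry_eq _ _ _ hd hd _ Φ

end Literature.NumberTheory.Automorphic.SchwartzBruhat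

/-! ## §2 Smooth pairs with an `L²`-isometric operator give unitary pairs -/

namespace Literature.RepresentationTheory.HeisenbergGroup

open Literature.NumberTheory.Automorphic

variable {R : Type*} [CommRing R] [Invertible (2 : R)] {X Y : Type*} [AddCommGroup X] [Module R X] [AddCommGroup Y]
  [Module R Y] (β : X →ₗ[R] Y →ₗ[R] R) (ψ : AddChar R Circle) [TopologicalSpace X] [TopologicalSpace R]
  [IsTopologicalAddGroup X] (hψ : IsLocallyConstant (⇑ψ : R → Circle)) (hβ : ∀ y : Y, Continuous fun u : X => β u y)
  [MeasurableSpace X] [BorelSpace X] (ν : Measure X) [IsFiniteMeasureOnCompacts ν] [MeasurableAdd X]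
  [ν.IsAddRightInvariant] (hd : DenseRange (SchwartzBruhat.toLp ν : SchwartzBruhat X → Lp ℂ 2 ν))

/-- **a smooth pair `(g, M) ∈ S̃p_ψ(W)` with `M` `L²`-isometric yields the unitary pair `(g, Û) ∈ MpPsi (schrodingerL2 …)`**,
`Û` the unitary extension of `M` (density: both sides of `Û ρ_ψ(h) = ρ_ψ(g h) Û` are continuous and agree on `𝒮(X)`).
[cite: MoeglinVignerasWaldspurger1987, Chap. 2 II.1 (A)] [cite: GelbartRogawski1991, §3.1 p. 454 L21–24] -/
theorem mem_MpPsi_schrodingerL2_unitaryExtend {p : symplecticGroup (polar β) × (SchwartzBruhat X ≃ₗ[ℂ] SchwartzBruhat X)}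
    (hp : p ∈ MpPsi (schrodingerSB β ψ hψ hβ))
    (hM : ∀ Φ, SchwartzBruhat.l2NormSq ν (p.2 Φ) = SchwartzBruhat.l2NormSq ν Φ) :
    (p.1, (SchwartzBruhat.unitaryExtend ν p.2 hM hd).toLinearEquiv) ∈ MpPsi (schrodingerL2 β ψ hψ hβ ν hd) := by
  rw [mem_MpPsi]
  intro h f
  have h1 := (mem_MpPsi _ p).1 hp h
  refine congrFun (hd.equalizer
    ((SchwartzBruhat.unitaryExtend ν p.2 hM hd).continuous.comp (continuous_schrodingerL2 β ψ hψ hβ ν hd h))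
    ((continuous_schrodingerL2 β ψ hψ hβ ν hd _).comp (SchwartzBruhat.unitaryExtend ν p.2 hM hd).continuous) ?_) f
  funext Φ
  simp only [Function.comp_apply, schrodingerL2_apply_toLp]
  show SchwartzBruhat.unitaryExtend ν p.2 hM hd (SchwartzBruhat.toLp ν (schrodingerSB β ψ hψ hβ h Φ)) = _
  rw [SchwartzBruhat.unitaryExtend_toLp, h1, ← schrodingerL2_apply_toLp β ψ hψ hβ ν hd]
  show _ = schrodingerL2 β ψ hψ hβ ν hd _ (SchwartzBruhat.unitaryExtend ν p.2 hM hd (SchwartzBruhat.toLp ν Φ))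
  rw [SchwartzBruhat.unitaryExtend_toLp]

end Literature.RepresentationTheory.HeisenbergGroup

/-! ## §3 `Mp_v(W)` = bounded pairs over `L²(F_vᴺ)`: the central extension -/

namespace Literature.NumberTheory.GelbartRogawski1991.UnitaryDualPair.LocalSplitting

open NumberField IsDedekindDomain Matrix
open Literature.RepresentationTheory.HeisenbergGroup
open Literature.NumberTheory.Automorphic Literature.NumberTheory.Weil1964
open Literature.NumberTheory.GaloisRepresentations Literature.RepresentationTheory.HarrisKudlaSweet1996
open Literature.NumberTheory.GaloisRepresentations.IsNonarchimedeanLocalField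
open Literature.RepresentationTheory.MoeglinVignerasWaldspurger1987 (IsCentralExt)

section Bdd

variable (F : Type) [Field F] [NumberField F] (N : ℕ) (T : Matrix (Fin N) (Fin N) F) (v : HeightOneSpectrum (𝓞 F))
  [MeasurableSpace (v.adicCompletion F)] [BorelSpace (v.adicCompletion F)]
  (μ' : Measure (v.adicCompletion F)) [μ'.IsAddHaarMeasure]

/-- **`Mp_v(W)` AS PRINTED**: the pairs `(g, M)`, `g ∈ Sp(𝕎_v)`, `M` a BOUNDED operator of the Hilbert space `L²(F_vᴺ, μ'ᴺ)`
with bounded inverse, such that `M ρ_{ψ_v}(h) = ρ_{ψ_v}(g h) M` (`MpPsi` of the unitary model meet `Prop311.boundedUnits`).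
[cite: GelbartRogawski1991, §3.1 p. 454 L21–24, L28–29] -/
def localMpL2Bdd : Subgroup (LocalSp F N T v ×
    (Lp ℂ 2 (Measure.pi fun _ : Fin N => μ') ≃ₗ[ℂ] Lp ℂ 2 (Measure.pi fun _ : Fin N => μ'))) :=
  MpPsi (localSchrodingerL2 F N T v μ') ⊓
    (Prop311.boundedUnits (Lp ℂ 2 (Measure.pi fun _ : Fin N => μ'))).comap (MonoidHom.snd _ _)

/-- membership in `Mp_v(W)`. [cite: GelbartRogawski1991, §3.1 p. 454 L21–24] -/
theorem mem_localMpL2Bdd (p : LocalSp F N T v ×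
    (Lp ℂ 2 (Measure.pi fun _ : Fin N => μ') ≃ₗ[ℂ] Lp ℂ 2 (Measure.pi fun _ : Fin N => μ'))) :
    p ∈ localMpL2Bdd F N T v μ' ↔
      p ∈ MpPsi (localSchrodingerL2 F N T v μ') ∧ Continuous p.2 ∧ Continuous p.2.symm :=
  Iff.rfl

/-- **`π_v((g, M_g)) = g`**. [cite: GelbartRogawski1991, §3.1 p. 454 L25, L28–29] -/
def localMpL2Bdd.proj : localMpL2Bdd F N T v μ' →* LocalSp F N T v :=
  (MonoidHom.fst _ _).comp (localMpL2Bdd F N T v μ').subtype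

/-- `π_v` on components. [cite: GelbartRogawski1991, §3.1 p. 454 L25] -/
@[simp] theorem localMpL2Bdd.proj_apply (x : localMpL2Bdd F N T v μ') :
    localMpL2Bdd.proj F N T v μ' x = x.1.1 := rfl

/-- **`i : ℂˣ → Mp_v(W)`, `c ↦ (1, c · id)`** (the scalars are bounded with bounded inverse).
[cite: GelbartRogawski1991, §3.1 p. 454 L26–27] -/
def localMpL2Bdd.ofScalar : ℂˣ →* localMpL2Bdd F N T v μ' where
  toFun c := ⟨((1 : LocalSp F N T v), scalarOp c),
    (mem_localMpL2Bdd F N T v μ' _).2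
      ⟨one_scalarOp_mem_MpPsi _ c, continuous_const_smul (c : ℂ), continuous_const_smul ((c⁻¹ : ℂˣ) : ℂ)⟩⟩
  map_one' := by
    apply Subtype.ext
    refine Prod.ext rfl (LinearEquiv.ext fun f => ?_)
    simp
  map_mul' c c' := by
    apply Subtype.ext
    refine Prod.ext (by simp) (LinearEquiv.ext fun f => ?_)
    simp only [Subgroup.coe_mul, Prod.snd_mul, LinearEquiv.mul_apply, scalarOp_apply, Units.val_mul, smul_smul]

/-- components of `i c`. [cite: GelbartRogawski1991, §3.1 p. 454 L26–27] -/
@[simp] theorem localMpL2Bdd.coe_ofScalar (c : ℂˣ) :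
    (localMpL2Bdd.ofScalar F N T v μ' c).1 = (1, scalarOp c) := rfl

/-- `π_v ∘ i = 1`. [cite: GelbartRogawski1991, §3.1 p. 454 L26–27] -/
theorem localMpL2Bdd.proj_ofScalar (c : ℂˣ) : localMpL2Bdd.proj F N T v μ' (localMpL2Bdd.ofScalar F N T v μ' c) = 1 := rfl

/-- `i(ℂˣ)` is central in `Mp_v(W)`. [cite: GelbartRogawski1991, §3.1 p. 454 L26–27] -/
theorem localMpL2Bdd.ofScalar_mem_center (c : ℂˣ) :
    localMpL2Bdd.ofScalar F N T v μ' c ∈ Subgroup.center (localMpL2Bdd F N T v μ') := by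
  rw [Subgroup.mem_center_iff]
  intro x
  apply Subtype.ext
  show x.1 * (localMpL2Bdd.ofScalar F N T v μ' c).1 = (localMpL2Bdd.ofScalar F N T v μ' c).1 * x.1
  rw [localMpL2Bdd.coe_ofScalar]
  refine Prod.ext ?_ (LinearEquiv.ext fun f => ?_)
  · simp
  · simp [LinearEquiv.mul_apply]

/-- `i` is injective. [cite: GelbartRogawski1991, §3.1 p. 454 L26–27] -/
theorem localMpL2Bdd.ofScalar_injective : Function.Injective (localMpL2Bdd.ofScalar F N T v μ') := by
  haveI := secondCountableTopology_adicCompletion F v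
  intro c c' e
  obtain ⟨f, hf⟩ := SchrodingerLevi.exists_ne_zero (Measure.pi fun _ : Fin N => μ')
  have h := congrArg (fun x : localMpL2Bdd F N T v μ' => x.1.2 f) e
  simp only [localMpL2Bdd.coe_ofScalar, scalarOp_apply] at h
  exact Units.ext (smul_left_injective ℂ hf h)

/-- **`π_v` is SURJECTIVE**: every `g ∈ Sp(𝕎_v)` has a UNITARY implementer on `L²(F_vᴺ)` — the unitary extension (§1) of
the tree's `L²`-isometric implementer on the smooth model (`exists_isometric_implementer_localSchrodinger`), which implements
`g` on the Hilbert space by §2. [cite: GelbartRogawski1991, §3.1 p. 454 L26–29] [cite: Weil1964, Chap. I n° 13] -/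
theorem localMpL2Bdd.proj_surjective (hTd : IsUnit T.det) : Function.Surjective (localMpL2Bdd.proj F N T v μ') := by
  haveI := secondCountableTopology_adicCompletion F v
  intro g
  obtain ⟨M, hM, hMi⟩ := exists_isometric_implementer_localSchrodinger (hTd := hTd) μ' g
  let U := SchwartzBruhat.unitaryExtend (Measure.pi fun _ : Fin N => μ') M hMi
    (SchwartzBruhat.denseRange_toLp_adicCompletionPi F v N μ')
  have hmem : (g, U.toLinearEquiv) ∈ MpPsi (localSchrodingerL2 F N T v μ') :=
    mem_MpPsi_schrodingerL2_unitaryExtend (localPairing F N T v) (adeleAddCharAt F v)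
      (isLocallyConstant_of_isContinuousNontrivial (isContinuousNontrivial_adeleAddCharAt F v))
      (continuous_toLinearMap₂'_left (localGram F N T v)) (Measure.pi fun _ : Fin N => μ')
      (SchwartzBruhat.denseRange_toLp_adicCompletionPi F v N μ') (p := (g, M)) hM hMi
  exact ⟨⟨(g, U.toLinearEquiv), (mem_localMpL2Bdd F N T v μ' _).2 ⟨hmem, U.continuous, U.symm.continuous⟩⟩, rfl⟩

/-- **`ker π_v ⊆ i(ℂˣ)`**: a bounded operator `M` with `(1, M) ∈ Mp_v(W)` commutes with the IRREDUCIBLE `ρ_{ψ_v}`, hence is a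
(non-zero) scalar — `hasScalarCommutant_localSchrodingerL2`. [cite: GelbartRogawski1991, §3.1 p. 454 L26–27]
[cite: MoeglinVignerasWaldspurger1987, Chap. 2 II.1 (B)] -/
theorem localMpL2Bdd.mem_range_ofScalar_of_proj_eq_one (hTd : IsUnit T.det) (x : localMpL2Bdd F N T v μ')
    (hx : localMpL2Bdd.proj F N T v μ' x = 1) : x ∈ (localMpL2Bdd.ofScalar F N T v μ').range := by
  haveI := secondCountableTopology_adicCompletion F v
  obtain ⟨⟨g, M⟩, hx'⟩ := x
  obtain ⟨hmp, hMc, -⟩ := (mem_localMpL2Bdd F N T v μ' _).1 hx'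
  simp only [localMpL2Bdd.proj_apply] at hx
  subst hx
  -- `M` commutes with every `ρ_{ψ_v}(h)`
  have hcomm : ∀ h f, M (localSchrodingerL2 F N T v μ' h f) = localSchrodingerL2 F N T v μ' h (M f) := by
    intro h f
    have := (mem_MpPsi _ _).1 hmp h f
    simpa only [map_one, Heisenberg.PseudoSymplectic.act_one] using this
  -- as a bounded operator it is a scalar
  let A : Lp ℂ 2 (Measure.pi fun _ : Fin N => μ') →L[ℂ] Lp ℂ 2 (Measure.pi fun _ : Fin N => μ') :=
    ⟨(M : _ →ₗ[ℂ] _), hMc⟩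
  obtain ⟨a, ha⟩ := hasScalarCommutant_localSchrodingerL2 F N T v μ' hTd A
    (by rintro S ⟨h, rfl⟩ f; exact hcomm h f)
  have ha' : ∀ f, M f = a • f := ha
  -- `a ≠ 0` since `M` is invertible and `L² ≠ 0`
  obtain ⟨f₀, hf₀⟩ := SchrodingerLevi.exists_ne_zero (Measure.pi fun _ : Fin N => μ')
  have ha0 : a ≠ 0 := by
    intro h0
    apply hf₀
    have h1 : M f₀ = 0 := by rw [ha', h0, zero_smul]
    simpa using congrArg M.symm h1
  refine ⟨Units.mk0 a ha0, Subtype.ext (Prod.ext rfl (LinearEquiv.ext fun f => ?_))⟩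
  simp [ha' f]

/-- **`ker π_v = i(ℂˣ)`**. [cite: GelbartRogawski1991, §3.1 p. 454 L26–27] -/
theorem localMpL2Bdd.ker_proj_eq_range_ofScalar (hTd : IsUnit T.det) :
    (localMpL2Bdd.proj F N T v μ').ker = (localMpL2Bdd.ofScalar F N T v μ').range := by
  ext x
  constructor
  · intro hx
    exact localMpL2Bdd.mem_range_ofScalar_of_proj_eq_one F N T v μ' hTd x ((MonoidHom.mem_ker).1 hx)
  · rintro ⟨c, rfl⟩
    exact (MonoidHom.mem_ker).2 (localMpL2Bdd.proj_ofScalar F N T v μ' c)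

/-- **THE EXACT SEQUENCE `1 → ℂˣ → Mp_v(W) → Sp(𝕎_v) → 1` for the printed bounded pairs over the tree's unitary model
`(L²(F_vᴺ), ρ_{ψ_v})`** — "The projection `π((g, M_g)) = g` yields an exact sequence `0 → ℂ* → Mp(W) → Sp(W) → 0`", at a
finite place, as the tree's predicate `IsCentralExt` (`i(ℂˣ)` central, `ker π_v ⊆ i(ℂˣ)`, `π_v` onto); with
`ofScalar_injective` and `proj_ofScalar` for the remaining printed clauses.
[cite: GelbartRogawski1991, §3.1 p. 454 L26–29] [cite: MoeglinVignerasWaldspurger1987, Chap. 2 II.1 (B)] -/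
theorem isCentralExt_localMpL2Bdd (hTd : IsUnit T.det) :
    IsCentralExt (localMpL2Bdd.ofScalar F N T v μ') (localMpL2Bdd.proj F N T v μ') :=
  ⟨localMpL2Bdd.ofScalar_mem_center F N T v μ',
    fun x hx => localMpL2Bdd.mem_range_ofScalar_of_proj_eq_one F N T v μ' hTd x hx,
    localMpL2Bdd.proj_surjective F N T v μ' hTd⟩

/-! ### Two homomorphisms over the same map to `Sp(𝕎_v)` differ by a character through the centre -/

/-- **abstract form** (any central extension `i : A → M`, `p : M → S` with `i` injective, `i(A)` central, `ker p ⊆ i(A)`):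
two homomorphisms `s, s' : G →* M` with `p ∘ s' = p ∘ s` differ by a homomorphism `η : G →* A`, `s'(g) = i(η g) s(g)`.
[cite: MoeglinVignerasWaldspurger1987, Chap. 2 II.1 (B)] -/
theorem _root_.Literature.RepresentationTheory.MoeglinVignerasWaldspurger1987.IsCentralExt.exists_hom_mul_eq
    {A : Type*} {M : Type*} {S : Type*} [CommGroup A] [Group M] [Group S] {i : A →* M} {p : M →* S}
    (hE : IsCentralExt i p) (hi : Function.Injective i) {G : Type*} [Group G] (s s' : G →* M)
    (h : ∀ g, p (s' g) = p (s g)) : ∃ η : G →* A, ∀ g, s' g = i (η g) * s g := by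
  have hex : ∀ g, ∃ c : A, s' g = i c * s g := by
    intro g
    have hx : p ((s g)⁻¹ * s' g) = 1 := by rw [map_mul, map_inv, h g, inv_mul_cancel]
    obtain ⟨c, hc⟩ := hE.2.1 _ hx
    refine ⟨c, ?_⟩
    have hz : s g * i c = i c * s g := Subgroup.mem_center_iff.1 (hE.1 c) (s g)
    rw [← hz, hc, mul_inv_cancel_left]
  choose c hc using hex
  have hone : c 1 = 1 := by
    apply hi
    have e1 := hc 1
    rw [map_one, map_one, mul_one] at e1
    rw [map_one]
    exact e1.symm
  have hmul : ∀ a b, c (a * b) = c a * c b := by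
    intro a b
    apply hi
    have hz : s a * i (c b) = i (c b) * s a := Subgroup.mem_center_iff.1 (hE.1 (c b)) (s a)
    have e1 : s' (a * b) = i (c (a * b)) * s (a * b) := hc (a * b)
    have e2 : s' (a * b) = i (c a) * i (c b) * s (a * b) := by
      rw [map_mul s', hc a, hc b, map_mul s]
      calc i (c a) * s a * (i (c b) * s b) = i (c a) * (s a * i (c b)) * s b := by
            rw [mul_assoc, ← mul_assoc (s a), ← mul_assoc]
        _ = i (c a) * i (c b) * (s a * s b) := by rw [hz, ← mul_assoc, mul_assoc]
    rw [map_mul]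
    exact mul_right_cancel (e1.symm.trans e2)
  exact ⟨⟨⟨c, hone⟩, hmul⟩, hc⟩

/-- **two homomorphisms `s, s' : G →* Mp_v(W)` over the same map to `Sp(𝕎_v)` differ by a CHARACTER `η : G →* ℂˣ` through
the centre**: `s'(g) = i(η g) · s(g)` — the local, unitary-model form of "a choice of splitting … is equivalent to a choice
of [a character]" ([GelbartRogawski1991, §3.1 Remark p. 457]). [cite: GelbartRogawski1991, §3.1 Remark p. 457 L4–13]
[cite: MoeglinVignerasWaldspurger1987, Chap. 2 II.1 (B)] -/
theorem localMpL2Bdd.exists_character_of_proj_eq (hTd : IsUnit T.det) {G : Type*} [Group G]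
    (s s' : G →* localMpL2Bdd F N T v μ')
    (h : ∀ g, localMpL2Bdd.proj F N T v μ' (s' g) = localMpL2Bdd.proj F N T v μ' (s g)) :
    ∃ η : G →* ℂˣ, ∀ g, s' g = localMpL2Bdd.ofScalar F N T v μ' (η g) * s g :=
  (isCentralExt_localMpL2Bdd F N T v μ' hTd).exists_hom_mul_eq (localMpL2Bdd.ofScalar_injective F N T v μ') s s' h

/-- … and if both `s` and `s'` act by ISOMETRIES of `L²(F_vᴺ)` the character is UNITARY: `|η(g)| = 1`.
[cite: GelbartRogawski1991, §3.1 Remark p. 457 L4–13] -/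
theorem localMpL2Bdd.norm_character_eq_one_of_proj_eq {G : Type*} [Group G] (s s' : G →* localMpL2Bdd F N T v μ')
    (hs : ∀ g f, ‖(s g).1.2 f‖ = ‖f‖) (hs' : ∀ g f, ‖(s' g).1.2 f‖ = ‖f‖) (η : G →* ℂˣ)
    (hη : ∀ g, s' g = localMpL2Bdd.ofScalar F N T v μ' (η g) * s g) (g : G) : ‖((η g : ℂˣ) : ℂ)‖ = 1 := by
  haveI := secondCountableTopology_adicCompletion F v
  obtain ⟨f, hf⟩ := SchrodingerLevi.exists_ne_zero (Measure.pi fun _ : Fin N => μ')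
  have e : (s' g).1.2 f = ((η g : ℂˣ) : ℂ) • (s g).1.2 f := by
    rw [hη g]
    rfl
  have h1 : ‖f‖ = ‖((η g : ℂˣ) : ℂ)‖ * ‖f‖ := by
    conv_lhs => rw [← hs' g f, e, norm_smul, hs g f]
  have hf' : ‖f‖ ≠ 0 := norm_ne_zero_iff.2 hf
  field_simp at h1
  linarith [h1]

end Bdd

/-! ## §4 The local splitting lands in `Mp_v(W)` -/

section Datum

variable {F : Type} [Field F] [NumberField F] {E : Type} [Field E] [NumberField E] [Algebra F E]
  [Algebra.IsQuadraticExtension F E] {c : E ≃ₐ[F] E} {N : ℕ} {δ : E} {hcδ : c δ = -δ} {hδ : δ ≠ 0} {d : F}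
  {hd : δ * δ = algebraMap F E d} {T : Matrix (Fin N) (Fin N) F} {hT : T.IsSymm} {hTd : IsUnit T.det}
  {J : Matrix (Fin N) (Fin N) E} {hJ : J = T.map (algebraMap F E)} {v : HeightOneSpectrum (𝓞 F)}
  [MeasurableSpace (v.adicCompletion F)] [BorelSpace (v.adicCompletion F)]
  {μ : Measure (v.adicCompletion F)} [μ.IsAddHaarMeasure]
  {ℓ : Submodule (v.adicCompletion F) ((Fin N → v.adicCompletion F) × (Fin N → v.adicCompletion F))}
  {hℓ : LinearMap.BilinForm.orthogonal (alt (polar (localPairing F N T v))) ℓ = ℓ}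
  (D : LocalSplittingDatum F E c N hcδ hδ hd T hT hTd hJ v μ ℓ hℓ)
  (hβ : ∀ g : UnitaryGroup.localPi E c N J v, ‖((D.beta g : ℂˣ) : ℂ)‖ = 1)
  (μ' : Measure (v.adicCompletion F)) [μ'.IsAddHaarMeasure]

/-- **`s_v : U(J)(F_v) →* Mp_v(W)`** — the tree's local splitting in the printed group of bounded pairs (its operators
`U_g` are unitary, in particular bounded with bounded inverse). [cite: GelbartRogawski1991, §3.1 Prop. 3.1.1 p. 455 L1–3] -/
def LocalSplittingDatum.localSplittingL2Bdd : UnitaryGroup.localPi E c N J v →* localMpL2Bdd F N T v μ' where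
  toFun g := ⟨(D.localSplittingL2 hβ μ' g).1,
    (mem_localMpL2Bdd F N T v μ' _).2 ⟨(D.localSplittingL2 hβ μ' g).2, D.continuous_toOp_localSplittingL2 hβ μ' g⟩⟩
  map_one' := by
    apply Subtype.ext
    show (D.localSplittingL2 hβ μ' 1).1 = 1
    rw [map_one]
    rfl
  map_mul' g g' := by
    apply Subtype.ext
    show (D.localSplittingL2 hβ μ' (g * g')).1 = (D.localSplittingL2 hβ μ' g).1 * (D.localSplittingL2 hβ μ' g').1
    rw [map_mul]
    rfl

/-- `π_v ∘ s_v = ι_v`. [cite: GelbartRogawski1991, §3.1 Prop. 3.1.1 p. 455 L1] -/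
theorem LocalSplittingDatum.proj_localSplittingL2Bdd (g : UnitaryGroup.localPi E c N J v) :
    localMpL2Bdd.proj F N T v μ' (D.localSplittingL2Bdd hβ μ' g) = iota F E c N hcδ hδ hd T hT hJ v g := rfl

/-- the operator of `s_v(g)` in `Mp_v(W)` is `U_g = localOmegaL2 g`. [cite: GelbartRogawski1991, §3.1 p. 454 L24–25] -/
theorem LocalSplittingDatum.localSplittingL2Bdd_op_apply (g : UnitaryGroup.localPi E c N J v)
    (f : Lp ℂ 2 (Measure.pi fun _ : Fin N => μ')) :
    (D.localSplittingL2Bdd hβ μ' g).1.2 f = D.localOmegaL2 hβ μ' g f := rfl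

end Datum

end Literature.NumberTheory.GelbartRogawski1991.UnitaryDualPair.LocalSplitting

end
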